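import Literature.Geometry.Lorentzian.TeukolskyHorizonSupBoxPocket
import Summits.FinalStateConjecture.FinalStateConjecture.Theorems.PhaseMixingCaptureKappaExplicitWaveDecayOlverNormalForm

/-!
# Polynomial sup bound for the horizon-normalised scalar radial Teukolsky solution on a bounded
# frequency box (stub `stub_horizonSupBoxPoly`, T1h of the line `olver-dunster-uniform-reduction`)

Crux `PhaseMixingCapture.KappaExplicitWaveDecay` (stmt-FinalStateConjecture-10654), line
`olver-dunster-uniform-reduction`, stub T1h (skeleton v8/v9). For `M > 0` and every `Λ₀` there are
`a₁ < M`, `ε₀ > 0`, `C > 0`, `N` such that for `a₁ ≤ |a| < M`, admissible `(ω, m, Λ)` with `m ≠ 0`,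
`Λ ≤ Λ₀`, `|ω − mω₊| ≤ ε₀|m|`, every classical solution `R_𝓗` of the scalar radial Teukolsky ODE
(`λ = Λ − a²ω²`) normalised at `𝓗⁺` (Teixeira da Costa Def. 2.3) obeys
`√(r² + a²)‖R_𝓗(r)‖ ≤ C Λ^N κ^{-N}` for ALL `r > r₊` (`κ` the surface gravity). The regime
hypothesis `ω(ω − mω₊) ≤ 0 ∨ |ω − mω₊| ≤ 2ξ₀κ` of the registered statement is not needed and the
constants do not depend on `ξ₀`.

Assembly (pure plumbing over landed bricks; `X = κ⁻¹ ≥ 4M`, `d = r₊ − r₋ = 2κ(r₊² + a²)`,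
`σ = ω − mω₊`, `ξ = (2Mr₊/d)σ = σ/2κ`, port `D(r) = ‖R r‖ + (r − r₊)‖R′ r‖`):
* box facts `Kerr.cone_frequency_box` (`1 ≤ Λ ≤ Λ₁ = max Λ₀ 2`, `M|ω| ≤ Λ₁`, `|ω| ≥ 1/(16M)`,
  `|σ| ≤ ε₀√Λ₁`) and `Kerr.box_chart_constants`;
* the blown-up normal form `W″ = QW` from `stub_olverNormalForm` (S1, landed);
* POCKET (`Literature/Geometry/Lorentzian/TeukolskyHorizonSupBoxPocket.lean`):
  `Kerr.smallXi_pocket_box` (`|ξ| ≤ 1`, κ-free regular-singular energy, edge `x₁ = 1`) and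
  `Kerr.largeXi_pocket_box` (`|ξ| > 1`, Sonin on the pocket `x ≤ c₁|ξ|`, edge `x₁ = c₁|ξ|`);
  both `≤ K_P X⁹`;
* EULER ZONE `[r₊ + dx₁, R_F]` (`euler_zone`): `Kerr.euler_port_le` (`EulerZoneGrowth`), factor
  `(R_F/(dx₁))^{n+1} ≤ (R_F/(2M²c₁))^{n+1} X^{n+1}`;
* FAR ZONE `r ≥ R_F = max(7M, 16M√(12Λ₁), 256M)` (`farRadius_le`, `far_zone`):
  `Kerr.far_sup_of_port` (Sonin outward, `CarterFarSupBound`);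
then every piece is `≤ C X^{n+10} ≤ C Λ^{n+10} X^{n+10}` (`Λ ≥ 1`, `X ≥ 4M`). No named fact is used.
-/

-- the doubled `FinalStateConjecture.FinalStateConjecture` path component trips dupNamespace
set_option linter.dupNamespace false

noncomputable section

namespace Summit.FinalStateConjecture.FinalStateConjecture.Theorems.KappaExplicitWaveDecay.OlverDunsterUniformReduction

open Literature.Geometry.Lorentzian Literature.Analysis.ODE
open MeasureTheory Filter Set Complex
open scoped Topology ComplexConjugate

/-! ### Arithmetic -/

/-- Absorbing a lower power: for `0 < L ≤ X` and `j ≤ k`, `X^j ≤ X^k / L^(k − j)`. -/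
private theorem pow_le_pow_div_pow {X L : ℝ} {j k : ℕ} (hL : 0 < L) (hX : L ≤ X) (hjk : j ≤ k) :
    X ^ j ≤ X ^ k / L ^ (k - j) := by
  have hX0 : 0 ≤ X := hL.le.trans hX
  rw [le_div_iff₀ (pow_pos hL _)]
  calc X ^ j * L ^ (k - j) ≤ X ^ j * X ^ (k - j) := by gcongr
    _ = X ^ k := by rw [← pow_add, Nat.add_sub_cancel' hjk]

/-! ### The Euler zone and the far zone -/

/-- **Euler-zone transport, box form.** `Kerr.euler_port_le` (fed by the blown-up normal form of
`stub_olverNormalForm`) gives `D(r) ≤ 2(2 + 2/c₁)·2n·((R_F − r₊)/(dx₁))^{n+1}·D(r₊ + dx₁)` on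
`[r₊ + dx₁, R_F]`; with `1/d ≤ X/(2M²)` and `x₁ ≥ c₁` the growth factor is
`≤ (R_F/(2M²c₁))^{n+1} X^{n+1}`. -/
private theorem euler_zone {M a ω Λ Λ₁ c₁ RF X x₁ PB : ℝ} {m : ℤ} {n : ℕ} (hM : 0 < M)
    (ha : |a| < M) (hadm : Kerr.IsAdmissibleTriple a ω m Λ) (hΛ₁ : Λ ≤ Λ₁) (hωM : |ω| ≤ Λ₁ / M)
    (hc₀ : 0 < c₁) {R : ℝ → ℂ}
    (hR : Kerr.IsRadialTeukolskySolution M a 0 ω m (Λ - a ^ 2 * ω ^ 2) R) (hn1 : 1 ≤ n)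
    (hnK : 2 * Λ₁ + 1 / 4 + 2 / c₁ ^ 2 + 2 * (Λ₁ / M * (4 * M + RF)) ^ 2 ≤ (n : ℝ) ^ 2)
    (hRF0 : 0 < RF) (hX : X = (Kerr.surfaceGravity M a)⁻¹) (hx₁c : c₁ ≤ x₁)
    (hx₁ξ : c₁ * |2 * M * Kerr.rPlus M a / (Kerr.rPlus M a - Kerr.rMinus M a) *
        (ω - m * Kerr.horizonAngularVelocity M a)| ≤ x₁)
    (hx₁F : Kerr.rPlus M a + (Kerr.rPlus M a - Kerr.rMinus M a) * x₁ ≤ RF)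
    (hPB : ‖R (Kerr.rPlus M a + (Kerr.rPlus M a - Kerr.rMinus M a) * x₁)‖ +
          (Kerr.rPlus M a - Kerr.rMinus M a) * x₁ *
            ‖deriv R (Kerr.rPlus M a + (Kerr.rPlus M a - Kerr.rMinus M a) * x₁)‖ ≤ PB)
    {r : ℝ} (hr : r ∈ Icc (Kerr.rPlus M a + (Kerr.rPlus M a - Kerr.rMinus M a) * x₁) RF) :
    ‖R r‖ + (r - Kerr.rPlus M a) * ‖deriv R r‖ ≤
      2 * (2 + 2 / c₁) * (2 * n * (RF / (2 * M ^ 2 * c₁)) ^ (n + 1)) * X ^ (n + 1) * PB := by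
  obtain ⟨W', W'', hW⟩ := (stub_olverNormalForm.1 M a ω m Λ hM ha R).1 hR
  have hRd : ∀ s, Kerr.rPlus M a < s → DifferentiableAt ℝ R s := by
    obtain ⟨R', R'', h⟩ := hR
    exact fun s hs ↦ (h s hs).1.differentiableAt
  have h := Kerr.euler_port_le hM ha hadm hΛ₁ hωM hc₀ hRd hW hn1 hnK hx₁c hx₁ξ hx₁F hr
  obtain ⟨hd, -, hκ, hX4, hdinv, -, -, -, -⟩ := Kerr.box_chart_constants hM ha
  rw [← hX] at hX4 hdinv
  set d := Kerr.rPlus M a - Kerr.rMinus M a with hd_def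
  set rp := Kerr.rPlus M a with hrp
  have hX0 : 0 < X := lt_of_lt_of_le (by positivity) hX4
  have hrp0 : 0 < rp := Kerr.rPlus_pos hM a
  have hx₁ : 0 < x₁ := hc₀.trans_le hx₁c
  have hdx : 0 < d * x₁ := mul_pos hd hx₁
  have hPB0 : 0 ≤ PB := le_trans (by positivity) hPB
  have hratio : (RF - rp) / (d * x₁) ≤ RF / (2 * M ^ 2 * c₁) * X := by
    have h1 : (RF - rp) / (d * x₁) ≤ RF / (d * c₁) :=
      div_le_div₀ hRF0.le (by linarith) (by positivity) (mul_le_mul_of_nonneg_left hx₁c hd.le)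
    have h2 : RF / (d * c₁) = RF / c₁ * (1 / d) := by
      rw [div_mul_div_comm, mul_one, mul_comm c₁ d]
    have h3 : RF / c₁ * (1 / d) ≤ RF / c₁ * (X / (2 * M ^ 2)) :=
      mul_le_mul_of_nonneg_left hdinv (by positivity)
    have h4 : RF / c₁ * (X / (2 * M ^ 2)) = RF / (2 * M ^ 2 * c₁) * X := by ring
    linarith
  have hpow : ((RF - rp) / (d * x₁)) ^ (n + 1) ≤
      (RF / (2 * M ^ 2 * c₁)) ^ (n + 1) * X ^ (n + 1) := by
    rw [← mul_pow]
    exact pow_le_pow_left₀ (div_nonneg (by linarith) hdx.le) hratio _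
  calc _ ≤ _ := h
    _ ≤ 2 * (2 + 2 / c₁) * (2 * n * ((RF / (2 * M ^ 2 * c₁)) ^ (n + 1) * X ^ (n + 1))) * PB := by
        gcongr
    _ = _ := by ring

/-- **The far radius dominates the Sonin thresholds**: if `1/(16M) ≤ |ω|`, `Λ ≤ Λ₁` and
`R_F ≥ 7M, 16M√(12Λ₁), 256M`, then `max(7M, √(12Λ)/|ω|, 1/(Mω²)) ≤ R_F`. -/
private theorem farRadius_le {M ω Λ Λ₁ RF : ℝ} (hM : 0 < M) (hω : ω ≠ 0)
    (hω16 : 1 / (16 * M) ≤ |ω|) (hΛ₁ : Λ ≤ Λ₁) (h7 : 7 * M ≤ RF)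
    (h12 : 16 * M * Real.sqrt (12 * Λ₁) ≤ RF) (h256 : 256 * M ≤ RF) :
    max (7 * M) (max (Real.sqrt (12 * Λ) / |ω|) (1 / (M * ω ^ 2))) ≤ RF := by
  have hω0 : 0 < |ω| := abs_pos.2 hω
  have h16 : 1 ≤ 16 * M * |ω| := by
    rw [div_le_iff₀ (by positivity)] at hω16; linarith
  refine max_le h7 (max_le ?_ ?_)
  · calc Real.sqrt (12 * Λ) / |ω| ≤ 16 * M * Real.sqrt (12 * Λ₁) := by
          rw [div_le_iff₀ hω0]
          have h1 : Real.sqrt (12 * Λ) ≤ Real.sqrt (12 * Λ₁) := Real.sqrt_le_sqrt (by linarith)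
          have h2 : Real.sqrt (12 * Λ₁) * 1 ≤ Real.sqrt (12 * Λ₁) * (16 * M * |ω|) :=
            mul_le_mul_of_nonneg_left h16 (Real.sqrt_nonneg _)
          linarith
      _ ≤ RF := h12
  · calc 1 / (M * ω ^ 2) ≤ 256 * M := by
          rw [div_le_iff₀ (by positivity), ← sq_abs ω]
          nlinarith [h16, mul_pos hM hω0]
      _ ≤ RF := h256

/-- **Far zone, box form.** From `Kerr.far_sup_of_port` at `R_F ≥ 7M` and `r₊ ≤ 2M`, `|a| < M`:
the prefactor `√(R_F² + a²) + 23M(1 + √(R_F² + a²)/(R_F − r₊))` is at most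
`K_D = √(R_F² + M²) + 23M(1 + √(R_F² + M²)/(5M))`. -/
private theorem far_zone {M a RF KD B r : ℝ} {R : ℝ → ℂ} (hM : 0 < M) (ha : |a| < M)
    (h7 : 7 * M ≤ RF)
    (hKD : KD = Real.sqrt (RF ^ 2 + M ^ 2) + 23 * M * (1 + Real.sqrt (RF ^ 2 + M ^ 2) / (5 * M)))
    (hfar : Real.sqrt (r ^ 2 + a ^ 2) * ‖R r‖ ≤
      (Real.sqrt (RF ^ 2 + a ^ 2) +
          23 * M * (1 + Real.sqrt (RF ^ 2 + a ^ 2) / (RF - Kerr.rPlus M a))) *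
        (‖R RF‖ + (RF - Kerr.rPlus M a) * ‖deriv R RF‖))
    (hD : ‖R RF‖ + (RF - Kerr.rPlus M a) * ‖deriv R RF‖ ≤ B) :
    Real.sqrt (r ^ 2 + a ^ 2) * ‖R r‖ ≤ KD * B := by
  have hrp2 : Kerr.rPlus M a ≤ 2 * M := Kerr.rPlus_le_two_mul_self hM.le a
  have hgap : 5 * M ≤ RF - Kerr.rPlus M a := by linarith
  have hgap0 : 0 ≤ RF - Kerr.rPlus M a := le_trans (by positivity) hgap
  have ha2 : a ^ 2 ≤ M ^ 2 := by
    rw [← sq_abs a]; exact pow_le_pow_left₀ (abs_nonneg a) ha.le 2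
  have hsF : Real.sqrt (RF ^ 2 + a ^ 2) ≤ Real.sqrt (RF ^ 2 + M ^ 2) :=
    Real.sqrt_le_sqrt (by linarith)
  have h1 : Real.sqrt (RF ^ 2 + a ^ 2) / (RF - Kerr.rPlus M a) ≤
      Real.sqrt (RF ^ 2 + M ^ 2) / (5 * M) :=
    div_le_div₀ (Real.sqrt_nonneg _) hsF (by positivity) hgap
  have h2 : 23 * M * (1 + Real.sqrt (RF ^ 2 + a ^ 2) / (RF - Kerr.rPlus M a)) ≤
      23 * M * (1 + Real.sqrt (RF ^ 2 + M ^ 2) / (5 * M)) :=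
    mul_le_mul_of_nonneg_left (by linarith) (by positivity)
  have hKDle : Real.sqrt (RF ^ 2 + a ^ 2) +
      23 * M * (1 + Real.sqrt (RF ^ 2 + a ^ 2) / (RF - Kerr.rPlus M a)) ≤ KD := by
    rw [hKD]; exact add_le_add hsF h2
  have hD0 : 0 ≤ ‖R RF‖ + (RF - Kerr.rPlus M a) * ‖deriv R RF‖ := by positivity
  have hKD0 : 0 ≤ KD := le_trans (by positivity) hKDle
  exact hfar.trans (mul_le_mul hKDle hD hD0 hKD0)

/-! ### The stub -/

/-- **T1h · `stub_horizonSupBoxPoly` — polynomial sup bound for the horizon-normalised scalar radial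
Teukolsky solution on the bounded box `Λ ≤ Λ₀`, for all `r > r₊`.** See the module docstring for
the assembly: pockets (`|ξ| ≤ 1`: κ-free regular-singular energy in the blown-up chart;
`|ξ| > 1`: Sonin on the horizon pocket), Euler-zone transport in the blown-up chart, Sonin in the
far zone; every constant is a bounded-frequency constant times a power of `κ⁻¹ ≥ 4M`. -/
theorem stub_horizonSupBoxPoly :
    (∀ M : ℝ, 0 < M → ∀ ξ₀ : ℝ, 0 < ξ₀ → ∀ Λ₀ : ℝ, ∃ (a₁ ε₀ C : ℝ) (N : ℕ), a₁ < M ∧ 0 < ε₀ ∧ 0 < C ∧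
      ∀ a : ℝ, a₁ ≤ |a| → Kerr.IsSubextremal M a →
        ∀ (ω : ℝ) (m : ℤ) (Λ : ℝ), Kerr.IsAdmissibleTriple a ω m Λ → m ≠ 0 → Λ ≤ Λ₀ →
          |ω - m * Kerr.horizonAngularVelocity M a| ≤ ε₀ * |(m : ℝ)| →
          (ω * (ω - m * Kerr.horizonAngularVelocity M a) ≤ 0 ∨
              |ω - m * Kerr.horizonAngularVelocity M a| ≤ 2 * ξ₀ * Kerr.surfaceGravity M a) →
            ∀ RH : ℝ → ℂ,
              Kerr.IsRadialTeukolskySolution M a 0 ω m (Λ - a ^ 2 * ω ^ 2) RH →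
              Kerr.IsNormalisedHorizonSolution M a 0 ω m RH →
                ∀ r : ℝ, Kerr.rPlus M a < r →
                  Real.sqrt (r ^ 2 + a ^ 2) * ‖RH r‖ ≤ C * Λ ^ N * (Kerr.surfaceGravity M a)⁻¹ ^ N) := by
  intro M hM ξ₀ _ Λ₀
  /- box constants (depend on `M, Λ₀` only; kept opaque) -/
  obtain ⟨Λ₁, hΛ₁⟩ : ∃ Λ₁ : ℝ, Λ₁ = max Λ₀ 2 := ⟨_, rfl⟩
  have hΛ₁2 : 2 ≤ Λ₁ := by rw [hΛ₁]; exact le_max_right _ _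
  have hΛ₁0 : 0 < Λ₁ := by linarith
  obtain ⟨c₁, hc₁⟩ : ∃ c₁ : ℝ, c₁ = 1 / (32 * Λ₁ + 48) := ⟨_, rfl⟩
  have hc₁0 : 0 < c₁ := by rw [hc₁]; positivity
  have hc₁1 : c₁ ≤ 1 := by
    rw [hc₁, div_le_one (by positivity)]; linarith
  have hsΛ₁ : 0 < Real.sqrt Λ₁ := Real.sqrt_pos.2 hΛ₁0
  obtain ⟨ε₀, hε₀⟩ : ∃ ε₀ : ℝ, ε₀ = min (1 / (16 * M)) (1 / (8 * M * c₁ * Real.sqrt Λ₁)) :=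
    ⟨_, rfl⟩
  have hε₀0 : 0 < ε₀ := by rw [hε₀]; exact lt_min (by positivity) (by positivity)
  have hε₀16 : ε₀ ≤ 1 / (16 * M) := by rw [hε₀]; exact min_le_left _ _
  have hε₀c : ε₀ ≤ 1 / (8 * M * c₁ * Real.sqrt Λ₁) := by rw [hε₀]; exact min_le_right _ _
  obtain ⟨RF, hRF⟩ : ∃ RF : ℝ, RF = max (7 * M) (max (16 * M * Real.sqrt (12 * Λ₁)) (256 * M)) :=
    ⟨_, rfl⟩
  have hRF7 : 7 * M ≤ RF := by rw [hRF]; exact le_max_left _ _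
  have hRF12 : 16 * M * Real.sqrt (12 * Λ₁) ≤ RF := by
    rw [hRF]; exact (le_max_left _ _).trans (le_max_right _ _)
  have hRF256 : 256 * M ≤ RF := by rw [hRF]; exact (le_max_right _ _).trans (le_max_right _ _)
  have hRF0 : 0 < RF := by linarith
  obtain ⟨n, hn⟩ : ∃ n : ℕ,
      n = ⌈2 * Λ₁ + 1 / 4 + 2 / c₁ ^ 2 + 2 * (Λ₁ / M * (4 * M + RF)) ^ 2⌉₊ + 1 := ⟨_, rfl⟩
  have hn1 : 1 ≤ n := by rw [hn]; exact Nat.le_add_left 1 _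
  have hn1' : (1 : ℝ) ≤ n := by exact_mod_cast hn1
  have hnK : 2 * Λ₁ + 1 / 4 + 2 / c₁ ^ 2 + 2 * (Λ₁ / M * (4 * M + RF)) ^ 2 ≤ (n : ℝ) ^ 2 := by
    have h1 : 2 * Λ₁ + 1 / 4 + 2 / c₁ ^ 2 + 2 * (Λ₁ / M * (4 * M + RF)) ^ 2 ≤ (n : ℝ) := by
      rw [hn]; push_cast
      exact (Nat.le_ceil _).trans (le_add_of_nonneg_right zero_le_one)
    exact h1.trans (by simpa using le_self_pow₀ hn1' two_ne_zero)
  -- port constants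
  obtain ⟨S₁, hS₁⟩ : ∃ S₁ : ℝ,
      S₁ = Real.sqrt (Real.exp ((1 + (4 * Λ₁ + 6 * Λ₁ * (2 + 6 * Λ₁) + 15 / 4)) ^ 2) / M ^ 2) :=
    ⟨_, rfl⟩
  have hS₁0 : 0 ≤ S₁ := by rw [hS₁]; exact Real.sqrt_nonneg _
  obtain ⟨Φ₁, hΦ₁⟩ : ∃ Φ₁ : ℝ, Φ₁ = (Λ₁ / M) ^ 2 + 6 * Λ₁ / M ^ 2 := ⟨_, rfl⟩
  have hΦ₁0 : 0 ≤ Φ₁ := by rw [hΦ₁]; positivity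
  obtain ⟨KP, hKP⟩ : ∃ KP : ℝ, KP = (5 * M + 7) * S₁ / (4 * M) ^ 9 +
      (200 * Φ₁) ^ 4 * (49 / (4 * M) + 98 / (4 * M ^ 2) + Real.sqrt Λ₁ / M ^ 2) := ⟨_, rfl⟩
  have hKPA0 : 0 ≤ (5 * M + 7) * S₁ / (4 * M) ^ 9 := by positivity
  have hKPB0 : 0 ≤ (200 * Φ₁) ^ 4 * (49 / (4 * M) + 98 / (4 * M ^ 2) + Real.sqrt Λ₁ / M ^ 2) := by
    positivity
  have hKPA : (5 * M + 7) * S₁ / (4 * M) ^ 9 ≤ KP := by rw [hKP]; linarith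
  have hKPB : (200 * Φ₁) ^ 4 * (49 / (4 * M) + 98 / (4 * M ^ 2) + Real.sqrt Λ₁ / M ^ 2) ≤ KP := by
    rw [hKP]; linarith
  have hKP0 : 0 ≤ KP := hKPA0.trans hKPA
  obtain ⟨KB, hKB⟩ : ∃ KB : ℝ,
      KB = 2 * (2 + 2 / c₁) * (2 * n * (RF / (2 * M ^ 2 * c₁)) ^ (n + 1)) := ⟨_, rfl⟩
  have hKB0 : 0 ≤ KB := by rw [hKB]; positivity
  obtain ⟨KD, hKD⟩ : ∃ KD : ℝ,
      KD = Real.sqrt (RF ^ 2 + M ^ 2) + 23 * M * (1 + Real.sqrt (RF ^ 2 + M ^ 2) / (5 * M)) :=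
    ⟨_, rfl⟩
  have hKD0 : 0 ≤ KD := by rw [hKD]; positivity
  have hSF0 : 0 ≤ Real.sqrt (RF ^ 2 + M ^ 2) := Real.sqrt_nonneg _
  obtain ⟨C, hC⟩ : ∃ C : ℝ,
      C = KP / (4 * M) ^ (n + 1) + Real.sqrt (RF ^ 2 + M ^ 2) * KB * KP + KD * KB * KP + 1 :=
    ⟨_, rfl⟩
  have hCt1 : 0 ≤ KP / (4 * M) ^ (n + 1) := by positivity
  have hCt2 : 0 ≤ Real.sqrt (RF ^ 2 + M ^ 2) * KB * KP := mul_nonneg (mul_nonneg hSF0 hKB0) hKP0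
  have hCt3 : 0 ≤ KD * KB * KP := mul_nonneg (mul_nonneg hKD0 hKB0) hKP0
  have hC0 : 0 < C := by rw [hC]; linarith
  have hC1 : KP / (4 * M) ^ (n + 1) ≤ C := by rw [hC]; linarith
  have hC2 : Real.sqrt (RF ^ 2 + M ^ 2) * KB * KP ≤ C := by rw [hC]; linarith
  have hC3 : KD * KB * KP ≤ C := by rw [hC]; linarith
  refine ⟨M / 2, ε₀, C, n + 10, by linarith, hε₀0, hC0, ?_⟩
  intro a ha hsub ω m Λ hadm hm hΛ₀ hcone _ RH hRH hnH r hr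
  have ha' : |a| < M := hsub
  /- per-frequency facts -/
  obtain ⟨hΛ1, hΛle, hMω, hω16, hω0, hσε⟩ :=
    Kerr.cone_frequency_box hM ha hadm hm hΛ₀ hε₀0 hε₀16 hcone
  rw [← hΛ₁] at hΛle hMω hσε
  obtain ⟨-, -, -, hX4, -, -, -, -, -⟩ := Kerr.box_chart_constants hM ha'
  obtain ⟨X, hX⟩ : ∃ X : ℝ, X = (Kerr.surfaceGravity M a)⁻¹ := ⟨_, rfl⟩
  rw [← hX] at hX4 ⊢
  have hωM : |ω| ≤ Λ₁ / M := by rw [le_div_iff₀ hM]; linarith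
  have hM4 : 0 < 4 * M := by positivity
  have hX0 : 0 < X := hM4.trans_le hX4
  have hX9 : (4 * M) ^ 9 ≤ X ^ 9 := pow_le_pow_left₀ hM4.le hX4 9
  /- the pocket in the port: `x₁ = 1` for `|ξ| ≤ 1`, `x₁ = c₁|ξ|` for `|ξ| > 1` -/
  obtain ⟨W', W'', hW⟩ := ((stub_olverNormalForm.1 M a ω m Λ hM ha' RH).1 hRH)
  obtain ⟨x₁, hx₁c, hx₁ξ, hx₁F, hreg1, hport1⟩ :=
    (le_or_gt |2 * M * Kerr.rPlus M a / (Kerr.rPlus M a - Kerr.rMinus M a) *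
        (ω - m * Kerr.horizonAngularVelocity M a)| 1).elim
      (fun hξ1 ↦ Kerr.smallXi_pocket_box hM ha' hadm hΛle hMω hξ1 hRH hnH hW hc₁1 hRF7 hX9 hS₁ hKPA)
      (fun hξ1 ↦ Kerr.largeXi_pocket_box hM ha' hadm hΛ1 hΛle hωM hc₁ hε₀0 hσε hε₀16 hε₀c hRF7 hξ1
        hRH hnH hX hΦ₁.symm.le hKPB)
  have hport0 : 0 ≤ KP * X ^ 9 := mul_nonneg hKP0 (pow_nonneg hX0.le 9)
  /- the Euler zone -/
  have heuler : ∀ r' ∈ Icc (Kerr.rPlus M a + (Kerr.rPlus M a - Kerr.rMinus M a) * x₁) RF,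
      ‖RH r'‖ + (r' - Kerr.rPlus M a) * ‖deriv RH r'‖ ≤ KB * X ^ (n + 1) * (KP * X ^ 9) := by
    intro r' hr'
    have h := euler_zone hM ha' hadm hΛle hωM hc₁0 hRH hn1 hnK hRF0 hX hx₁c hx₁ξ hx₁F hport1 hr'
    rwa [← hKB] at h
  /- bookkeeping of the powers of `X` -/
  have hΛN : (1 : ℝ) ≤ Λ ^ (n + 10) := one_le_pow₀ hΛ1
  have hXN0 : 0 ≤ X ^ (n + 10) := pow_nonneg hX0.le _
  have hfinal : ∀ {B : ℝ}, Real.sqrt (r ^ 2 + a ^ 2) * ‖RH r‖ ≤ B → B ≤ C * X ^ (n + 10) →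
      Real.sqrt (r ^ 2 + a ^ 2) * ‖RH r‖ ≤ C * Λ ^ (n + 10) * X ^ (n + 10) := by
    intro B h1 h2
    calc _ ≤ C * X ^ (n + 10) := h1.trans h2
      _ = C * 1 * X ^ (n + 10) := by ring
      _ ≤ C * Λ ^ (n + 10) * X ^ (n + 10) :=
          mul_le_mul_of_nonneg_right (mul_le_mul_of_nonneg_left hΛN hC0.le) hXN0
  have hX9N : X ^ 9 ≤ X ^ (n + 10) / (4 * M) ^ (n + 1) := by
    have h := pow_le_pow_div_pow hM4 hX4 (by omega : 9 ≤ n + 10)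
    rwa [show n + 10 - 9 = n + 1 by omega] at h
  have hXsplit : X ^ (n + 1) * X ^ 9 = X ^ (n + 10) := by rw [← pow_add]
  /- the three regions -/
  rcases le_or_gt r (Kerr.rPlus M a + (Kerr.rPlus M a - Kerr.rMinus M a) * x₁) with hr₁ | hr₁
  · -- region 1: the pocket
    refine hfinal (hreg1 r hr hr₁) ?_
    calc KP * X ^ 9 ≤ KP * (X ^ (n + 10) / (4 * M) ^ (n + 1)) :=
          mul_le_mul_of_nonneg_left hX9N hKP0
      _ = KP / (4 * M) ^ (n + 1) * X ^ (n + 10) := by ring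
      _ ≤ C * X ^ (n + 10) := mul_le_mul_of_nonneg_right hC1 hXN0
  · rcases le_or_gt r RF with hrF | hrF
    · -- region 2: the Euler zone
      have hD := heuler r ⟨hr₁.le, hrF⟩
      have hr0 : 0 < r := (Kerr.rPlus_pos hM a).trans hr
      have hgap : 0 ≤ r - Kerr.rPlus M a := by linarith
      have ha2 : a ^ 2 ≤ M ^ 2 := by
        rw [← sq_abs a]; exact pow_le_pow_left₀ (abs_nonneg a) ha'.le 2
      have hsr : Real.sqrt (r ^ 2 + a ^ 2) ≤ Real.sqrt (RF ^ 2 + M ^ 2) :=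
        Real.sqrt_le_sqrt (add_le_add (pow_le_pow_left₀ hr0.le hrF 2) ha2)
      have hRD : ‖RH r‖ ≤ KB * X ^ (n + 1) * (KP * X ^ 9) :=
        le_trans (le_add_of_nonneg_right (mul_nonneg hgap (norm_nonneg _))) hD
      refine hfinal (mul_le_mul hsr hRD (norm_nonneg _) hSF0) ?_
      calc Real.sqrt (RF ^ 2 + M ^ 2) * (KB * X ^ (n + 1) * (KP * X ^ 9))
          = Real.sqrt (RF ^ 2 + M ^ 2) * KB * KP * X ^ (n + 10) := by rw [← hXsplit]; ring
        _ ≤ C * X ^ (n + 10) := mul_le_mul_of_nonneg_right hC2 hXN0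
    · -- region 3: the far zone
      have hRFfar := farRadius_le hM hω0 hω16 hΛle hRF7 hRF12 hRF256
      have hfar := Kerr.far_sup_of_port hM ha' hω0 hω16 hadm hRH hRFfar hrF.le
      have hD := heuler RF ⟨hx₁F, le_rfl⟩
      refine hfinal (far_zone hM ha' hRF7 hKD hfar hD) ?_
      calc KD * (KB * X ^ (n + 1) * (KP * X ^ 9)) = KD * KB * KP * X ^ (n + 10) := by
            rw [← hXsplit]; ring
        _ ≤ C * X ^ (n + 10) := mul_le_mul_of_nonneg_right hC3 hXN0

end Summit.FinalStateConjecture.FinalStateConjecture.Theorems.KappaExplicitWaveDecay.OlverDunsterUniformReduction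

end
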